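import Summits.CriticalPhenomena.PercolationContinuityZ3.Theorems.PercNearOneGluingNoHeavyLowerTailKNConj4OfCSH
import Summits.CriticalPhenomena.PercolationContinuityZ3.Theorems.PercNearOneGluingNoHeavyLowerTailCovTauStarHPrelim
import HarnessLib

/-!
# Conjecture G / SET-W via a SET observer: the peeled-relay bound (two-set BHK) — seat (b) V⁺-form `png-dp-vplus`, gen 12

Support file (`--supports stmt-CriticalPhenomena-4576`); no definitions, no named facts, no sorries.

Setting (memo MEMO-gen12.md of run/shared/lean/prim/prim-png-dp-vplus/): the standalone conjecture G (`stub_fingerML3_vp`)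
is the statement SET-W, i.e. Kozma–Nitzan's display (3) at the CONTRACTED observer `z = [O]` of `Γ/O` with the witness `c`
designated in `Γ`.  It is implied by the following inequality living entirely in `Γ` with a SET observer `O` that enters only
through the increasing events `{O ~ u} := ⋃_{o∈O} {o ↔ u}`:
  (S-Δ)  `Σ_{a ∈ X} ∫_{P^O_a} (F(C_a) − F(C_c)) ≥ 0`,  `P^O_a = {O ~ a} ∩ ⋂_{r a' < r a} {O ≁ a'}`,  `c = argmin_X E F(C_·)`,
the set-observer version of Kozma–Nitzan's Conjecture 4 (tree: `PreFKGSurplus.kn_conj4_holds`, observer a point).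
THIS FILE: the analogue, for a set observer, of the one-cluster step of `PreFKGSurplus.kn_conj4_of_csh`
(there: vdBHK Thm 1.3 for `C_k` given `k ↮ X'`); here the event `{O ~ k} ∩ {O ≁ X'}` is increasing in `C_k` and
decreasing in `C_{X'}`, so vdBHK's Theorem 1.5 / 2.1 with vertex SETS (`BHK2006_twoSetConditionalAssociation`) is used twice:
* `setObserver_peel_bound`:
  `μ(k ↮ X') · ∫_{{O~k}∩{O≁X'}} (F(C_k) − F(C_c)) ≥ μ({O~k}∩{O≁X'}) · ∫_{k ↮ X'} (F(C_k) − F(C_c))`  (`c ∈ X'`, `F` monotone).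
[cite: VandenbergHaggstromKahn2005, Thm. 1.5 (p. 7), Thm. 2.1 (p. 9), Remark 1 after Thm. 1.2 (p. 5)]
[cite: KozmaNitzan2024, Conj. 4 (p. 32), display (3) (p. 3), Thm 4 (pp. 12–14)]
-/

noncomputable section

namespace Summit.CriticalPhenomena.PercolationContinuityZ3.Theorems

open MeasureTheory Set Literature.Probability.LatticeModels Literature.Probability.Percolation
open scoped Classical
open KNPreFKG

namespace SetSurplus

variable {n : ℕ}

/-- `O ~ X'` read off BHK's edge cluster `C_{X'} = ⋃_{t∈X'} C_t`: some `o ∈ O` is joined to some `a ∈ X'` iff `o ∈ X'` or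
`o` lies on an edge of `C_{X'}`. [cite: VandenbergHaggstromKahn2005, §1 p. 3, §2 p. 9] -/
theorem exists_reachable_iff_mem_biUnion (ω : BondConfig (Fin n)) (X' : Finset (Fin n)) (o : Fin n) :
    (∃ a ∈ X', (openGraph ω).Reachable o a) ↔
      (o ∈ X' ∨ ∃ e ∈ (⋃ t ∈ (↑X' : Set (Fin n)), openEdgeCluster ω t), o ∈ e) := by
  constructor
  · rintro ⟨a, ha, hoa⟩
    rcases (reachable_iff_exists_mem_openEdgeCluster ω a o).1 hoa.symm with h | ⟨e, he, hoe⟩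
    · exact Or.inl (h ▸ ha)
    · exact Or.inr ⟨e, mem_iUnion₂.2 ⟨a, Finset.mem_coe.2 ha, he⟩, hoe⟩
  · rintro (h | ⟨e, he, hoe⟩)
    · exact ⟨o, h, SimpleGraph.Reachable.refl _⟩
    · obtain ⟨a, ha, hea⟩ := mem_iUnion₂.1 he
      exact ⟨a, Finset.mem_coe.1 ha, ((reachable_iff_exists_mem_openEdgeCluster ω a o).2 (Or.inr ⟨e, hea, hoe⟩)).symm⟩

/-- **The peeled-relay bound for a SET observer** (two-set vdBHK, used twice).  For a relay set `X' ∋ c`, a vertex `k`, an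
observer set `O` and a monotone `F`:
`μ({O~k} ∩ {O≁X'}) · ∫_{k↮X'} (F(C_k) − F(C_c)) ≤ μ(k↮X') · ∫_{{O~k}∩{O≁X'}} (F(C_k) − F(C_c))`.
(`{O~k}∩{O≁X'}` is increasing in `C_k`, decreasing in `C_{X'}`; `F(C_k)` is increasing in `C_k`; `F(C_c)` is increasing in `C_{X'}`.)
[cite: VandenbergHaggstromKahn2005, Thm. 2.1 (p. 9) at q = 1, Remark 1 (p. 5)] -/
theorem setObserver_peel_bound (w : Sym2 (Fin n) → unitInterval) (X' O : Finset (Fin n)) (F : Set (Fin n) → ℝ)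
    (hF : ∀ S T : Set (Fin n), S ⊆ T → F S ≤ F T) (c k : Fin n) (hcX' : c ∈ X') :
    (prodBernoulli w).real ({ω : BondConfig (Fin n) | ∃ o ∈ O, (openGraph ω).Reachable o k} ∩
        {ω | ∀ o ∈ O, ∀ a ∈ X', ¬ (openGraph ω).Reachable o a}) *
      ∫ ω in {ω : BondConfig (Fin n) | ∀ a ∈ (↑X' : Set (Fin n)), ¬ (openGraph ω).Reachable k a},
        (F (openCluster ω k) - F (openCluster ω c)) ∂(prodBernoulli w) ≤
    (prodBernoulli w).real {ω : BondConfig (Fin n) | ∀ a ∈ (↑X' : Set (Fin n)), ¬ (openGraph ω).Reachable k a} *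
      ∫ ω in {ω : BondConfig (Fin n) | ∃ o ∈ O, (openGraph ω).Reachable o k} ∩
          {ω | ∀ o ∈ O, ∀ a ∈ X', ¬ (openGraph ω).Reachable o a},
        (F (openCluster ω k) - F (openCluster ω c)) ∂(prodBernoulli w) := by
  set μ := prodBernoulli w with hμ
  have hmeas : ∀ S : Set (BondConfig (Fin n)), MeasurableSet S := fun _ => MeasurableSet.of_discrete
  have hint : ∀ (g : BondConfig (Fin n) → ℝ) (S : Set (BondConfig (Fin n))), IntegrableOn g S μ :=
    fun g S => (Integrable.of_finite).integrableOn
  set D : Set (BondConfig (Fin n)) :=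
    {ω | ∀ s ∈ ({k} : Set (Fin n)), ∀ t ∈ (↑X' : Set (Fin n)), ¬ (openGraph ω).Reachable s t} with hD
  set D' : Set (BondConfig (Fin n)) := {ω | ∀ a ∈ (↑X' : Set (Fin n)), ¬ (openGraph ω).Reachable k a} with hD'
  have hDD' : D = D' := by
    ext ω; simp only [hD, hD', mem_setOf_eq, mem_singleton_iff, forall_eq]
  set Ev : Set (BondConfig (Fin n)) := {ω : BondConfig (Fin n) | ∃ o ∈ O, (openGraph ω).Reachable o k} ∩
    {ω | ∀ o ∈ O, ∀ a ∈ X', ¬ (openGraph ω).Reachable o a} with hEv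
  have hEvD : Ev ⊆ D' := by
    rintro ω ⟨⟨o, ho, hok⟩, h2⟩ a ha hka
    exact h2 o ho a (Finset.mem_coe.1 ha) (hok.trans hka)
  -- the three test functions of `(C_S, C_T)`, `S = {k}`, `T = X'`
  set F₁ : Set (Sym2 (Fin n)) → Set (Sym2 (Fin n)) → ℝ := fun C _ => F {z | z = k ∨ ∃ e ∈ C, z ∈ e} with hF₁
  set G : Set (Sym2 (Fin n)) → Set (Sym2 (Fin n)) → ℝ := fun C E =>
    if (∃ o ∈ O, o = k ∨ ∃ e ∈ C, o ∈ e) ∧ (∀ o ∈ O, ¬ (o ∈ X' ∨ ∃ e ∈ E, o ∈ e)) then 1 else 0 with hG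
  set Fc : Set (Sym2 (Fin n)) → Set (Sym2 (Fin n)) → ℝ := fun _ E => - F {z | z = c ∨ ∃ e ∈ openEdgeCluster E c, z ∈ e}
    with hFc
  have hF₁m : ∀ E, Monotone fun C => F₁ C E := fun E => monotone_clusterFun k F hF
  have hF₁a : ∀ C, Antitone fun E => F₁ C E := fun C => antitone_const
  have hGm : ∀ E, Monotone fun C => G C E := by
    intro E C C' hCC'
    simp only [hG]
    by_cases h : (∃ o ∈ O, o = k ∨ ∃ e ∈ C, o ∈ e) ∧ (∀ o ∈ O, ¬ (o ∈ X' ∨ ∃ e ∈ E, o ∈ e))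
    · rw [if_pos h, if_pos ⟨h.1.imp fun o ho => ⟨ho.1, ho.2.imp id fun ⟨e, he, hoe⟩ => ⟨e, hCC' he, hoe⟩⟩, h.2⟩]
    · rw [if_neg h]; split_ifs <;> norm_num
  have hGa : ∀ C, Antitone fun E => G C E := by
    intro C E E' hEE'
    simp only [hG]
    by_cases h : (∃ o ∈ O, o = k ∨ ∃ e ∈ C, o ∈ e) ∧ (∀ o ∈ O, ¬ (o ∈ X' ∨ ∃ e ∈ E', o ∈ e))
    · rw [if_pos h, if_pos ⟨h.1, fun o ho h' => h.2 o ho (h'.imp id fun ⟨e, he, hoe⟩ => ⟨e, hEE' he, hoe⟩)⟩]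
    · rw [if_neg h]; split_ifs <;> norm_num
  have hFcm : ∀ E, Monotone fun C => Fc C E := fun E => monotone_const
  have hFca : ∀ C, Antitone fun E => Fc C E := by
    intro C E E' hEE'
    simp only [hFc]
    exact neg_le_neg (monotone_clusterFun c F hF (BHK2006.openEdgeCluster_mono hEE' c))
  have key1 := BHK2006_twoSetConditionalAssociation w ({k} : Set (Fin n)) (↑X' : Set (Fin n)) F₁ G hF₁m hF₁a hGm hGa
  have key2 := BHK2006_twoSetConditionalAssociation w ({k} : Set (Fin n)) (↑X' : Set (Fin n)) G Fc hGm hGa hFcm hFca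
  -- pointwise identifications
  have eF₁ : ∀ ω : BondConfig (Fin n), F₁ (⋃ s ∈ ({k} : Set (Fin n)), openEdgeCluster ω s)
      (⋃ t ∈ (↑X' : Set (Fin n)), openEdgeCluster ω t) = F (openCluster ω k) := by
    intro ω; simp only [hF₁, biUnion_singleton]; exact clusterFun_openEdgeCluster F ω k
  have eFc : ∀ ω : BondConfig (Fin n), Fc (⋃ s ∈ ({k} : Set (Fin n)), openEdgeCluster ω s)
      (⋃ t ∈ (↑X' : Set (Fin n)), openEdgeCluster ω t) = - F (openCluster ω c) := by
    intro ω; simp only [hFc]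
    rw [CovTauStarN.openEdgeCluster_biUnion_eq (Finset.mem_coe.2 hcX'), clusterFun_openEdgeCluster F ω c]
  have eG : ∀ ω : BondConfig (Fin n), G (⋃ s ∈ ({k} : Set (Fin n)), openEdgeCluster ω s)
      (⋃ t ∈ (↑X' : Set (Fin n)), openEdgeCluster ω t) = Ev.indicator (1 : BondConfig (Fin n) → ℝ) ω := by
    intro ω
    simp only [hG, biUnion_singleton]
    have e1 : (∃ o ∈ O, o = k ∨ ∃ e ∈ openEdgeCluster ω k, o ∈ e) ↔ ∃ o ∈ O, (openGraph ω).Reachable o k := by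
      constructor
      · rintro ⟨o, ho, h⟩; exact ⟨o, ho, ((reachable_iff_exists_mem_openEdgeCluster ω k o).2 h).symm⟩
      · rintro ⟨o, ho, h⟩; exact ⟨o, ho, (reachable_iff_exists_mem_openEdgeCluster ω k o).1 h.symm⟩
    have e2 : (∀ o ∈ O, ¬ (o ∈ X' ∨ ∃ e ∈ (⋃ t ∈ (↑X' : Set (Fin n)), openEdgeCluster ω t), o ∈ e)) ↔
        ∀ o ∈ O, ∀ a ∈ X', ¬ (openGraph ω).Reachable o a := by
      refine forall₂_congr fun o _ => ?_
      rw [← exists_reachable_iff_mem_biUnion ω X' o]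
      simp only [not_exists, not_and]
    by_cases hω : ω ∈ Ev
    · rw [indicator_of_mem hω, Pi.one_apply, if_pos (⟨e1.2 hω.1, e2.2 hω.2⟩)]
    · rw [indicator_of_notMem hω, if_neg (fun h => hω ⟨e1.1 h.1, e2.1 h.2⟩)]
  -- rewrite the four integrals
  have i1 : ∫ ω in D, F₁ (⋃ s ∈ ({k} : Set (Fin n)), openEdgeCluster ω s) (⋃ t ∈ (↑X' : Set (Fin n)), openEdgeCluster ω t) ∂μ =
      ∫ ω in D', F (openCluster ω k) ∂μ := by
    rw [hDD']; exact setIntegral_congr_fun (hmeas _) fun ω _ => eF₁ ω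
  have i2 : ∫ ω in D, G (⋃ s ∈ ({k} : Set (Fin n)), openEdgeCluster ω s) (⋃ t ∈ (↑X' : Set (Fin n)), openEdgeCluster ω t) ∂μ =
      μ.real Ev := by
    rw [hDD', setIntegral_congr_fun (hmeas _) fun ω _ => eG ω, setIntegral_indicator_one_eq, inter_eq_self_of_subset_right hEvD]
  have i3 : ∫ ω in D, F₁ (⋃ s ∈ ({k} : Set (Fin n)), openEdgeCluster ω s) (⋃ t ∈ (↑X' : Set (Fin n)), openEdgeCluster ω t) *
        G (⋃ s ∈ ({k} : Set (Fin n)), openEdgeCluster ω s) (⋃ t ∈ (↑X' : Set (Fin n)), openEdgeCluster ω t) ∂μ =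
      ∫ ω in Ev, F (openCluster ω k) ∂μ := by
    rw [hDD', setIntegral_congr_fun (hmeas _) fun ω _ => by rw [eF₁ ω, eG ω], setIntegral_mul_indicator_one,
      inter_eq_self_of_subset_right hEvD]
  have i4 : ∫ ω in D, Fc (⋃ s ∈ ({k} : Set (Fin n)), openEdgeCluster ω s) (⋃ t ∈ (↑X' : Set (Fin n)), openEdgeCluster ω t) ∂μ =
      - ∫ ω in D', F (openCluster ω c) ∂μ := by
    rw [hDD', setIntegral_congr_fun (hmeas _) fun ω _ => eFc ω, integral_neg]
  have i5 : ∫ ω in D, G (⋃ s ∈ ({k} : Set (Fin n)), openEdgeCluster ω s) (⋃ t ∈ (↑X' : Set (Fin n)), openEdgeCluster ω t) *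
        Fc (⋃ s ∈ ({k} : Set (Fin n)), openEdgeCluster ω s) (⋃ t ∈ (↑X' : Set (Fin n)), openEdgeCluster ω t) ∂μ =
      - ∫ ω in Ev, F (openCluster ω c) ∂μ := by
    rw [hDD', setIntegral_congr_fun (hmeas _) fun ω _ => by rw [eFc ω, eG ω, mul_comm, neg_mul],
      integral_neg, setIntegral_mul_indicator_one, inter_eq_self_of_subset_right hEvD]
  have hmD : μ.real D = μ.real D' := by rw [hDD']
  rw [i1, i2, i3, hmD] at key1
  rw [i2, i4, i5, hmD] at key2
  rw [integral_sub (hint _ _) (hint _ _), integral_sub (hint _ _) (hint _ _)]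
  nlinarith [key1, key2]


/-! ### The set pre-FKG surplus along a rank, its peeling, and positivity from the set two-observer margin -/

/-- Membership in the first-touched pattern `P^O_a(X) = {O ~ a} ∩ ⋂_{a' ∈ X, r a' < r a} {O ≁ a'}`. [folklore] -/
theorem mem_pattern_iff (O X : Finset (Fin n)) (r : Fin n → ℕ) (a : Fin n) (ω : BondConfig (Fin n)) :
    ω ∈ ({ω : BondConfig (Fin n) | ∃ o ∈ O, (openGraph ω).Reachable o a} ∩
        {ω | ∀ a' ∈ X, r a' < r a → ∀ o ∈ O, ¬ (openGraph ω).Reachable o a'}) ↔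
      (∃ o ∈ O, (openGraph ω).Reachable o a) ∧ ∀ a' ∈ X, r a' < r a → ∀ o ∈ O, ¬ (openGraph ω).Reachable o a' :=
  Iff.rfl

/-- **Peeling the rank-maximal relay off the set pre-FKG surplus.**  If `k ∈ X` has the largest rank then
`Δ^r_O(X) = Δ^r_O(X ∖ k) + ∫_{{O~k} ∩ {O≁X∖k}} (F(C_k) − F(C_c))`. [cite: KozmaNitzan2024, Conj. 4 (p. 32)] -/
theorem setPreSurplus_erase_add (w : Sym2 (Fin n) → unitInterval) (O X : Finset (Fin n)) (r : Fin n → ℕ)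
    (F : Set (Fin n) → ℝ) (c k : Fin n) (hkX : k ∈ X) (hmax : ∀ a ∈ X, a ≠ k → r a < r k) :
    (∑ a ∈ X, ∫ ω in {ω : BondConfig (Fin n) | ∃ o ∈ O, (openGraph ω).Reachable o a} ∩
        {ω | ∀ a' ∈ X, r a' < r a → ∀ o ∈ O, ¬ (openGraph ω).Reachable o a'},
        (F (openCluster ω a) - F (openCluster ω c)) ∂(prodBernoulli w)) =
      (∑ a ∈ X.erase k, ∫ ω in {ω : BondConfig (Fin n) | ∃ o ∈ O, (openGraph ω).Reachable o a} ∩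
        {ω | ∀ a' ∈ X.erase k, r a' < r a → ∀ o ∈ O, ¬ (openGraph ω).Reachable o a'},
        (F (openCluster ω a) - F (openCluster ω c)) ∂(prodBernoulli w)) +
      ∫ ω in {ω : BondConfig (Fin n) | ∃ o ∈ O, (openGraph ω).Reachable o k} ∩
          {ω | ∀ o ∈ O, ∀ a ∈ X.erase k, ¬ (openGraph ω).Reachable o a},
        (F (openCluster ω k) - F (openCluster ω c)) ∂(prodBernoulli w) := by
  have hPa : ∀ a ∈ X.erase k,
      ({ω : BondConfig (Fin n) | ∃ o ∈ O, (openGraph ω).Reachable o a} ∩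
        {ω | ∀ a' ∈ X, r a' < r a → ∀ o ∈ O, ¬ (openGraph ω).Reachable o a'}) =
      ({ω : BondConfig (Fin n) | ∃ o ∈ O, (openGraph ω).Reachable o a} ∩
        {ω | ∀ a' ∈ X.erase k, r a' < r a → ∀ o ∈ O, ¬ (openGraph ω).Reachable o a'}) := by
    intro a ha
    have hak : a ≠ k := (Finset.mem_erase.1 ha).1
    have haX : a ∈ X := (Finset.mem_erase.1 ha).2
    ext ω
    refine and_congr Iff.rfl ⟨fun h a' ha' hlt => h a' (Finset.mem_erase.1 ha').2 hlt, fun h a' ha' hlt => ?_⟩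
    by_cases ha'k : a' = k
    · exact absurd (ha'k ▸ hlt) (not_lt.2 (hmax a haX hak).le)
    · exact h a' (Finset.mem_erase.2 ⟨ha'k, ha'⟩) hlt
  have hPk : ({ω : BondConfig (Fin n) | ∃ o ∈ O, (openGraph ω).Reachable o k} ∩
        {ω | ∀ a' ∈ X, r a' < r k → ∀ o ∈ O, ¬ (openGraph ω).Reachable o a'}) =
      ({ω : BondConfig (Fin n) | ∃ o ∈ O, (openGraph ω).Reachable o k} ∩
          {ω | ∀ o ∈ O, ∀ a ∈ X.erase k, ¬ (openGraph ω).Reachable o a}) := by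
    ext ω
    refine and_congr Iff.rfl ⟨fun h o ho a ha => h a (Finset.mem_erase.1 ha).2
      (hmax a (Finset.mem_erase.1 ha).2 (Finset.mem_erase.1 ha).1) o ho, fun h a' ha' hlt o ho => ?_⟩
    have : a' ≠ k := fun h' => (lt_irrefl _) (h' ▸ hlt)
    exact h o ho a' (Finset.mem_erase.2 ⟨this, ha'⟩)
  rw [← Finset.add_sum_erase X _ hkX, add_comm, hPk]
  congr 1
  exact Finset.sum_congr rfl fun a ha => by rw [hPa a ha]

/-- **The set pre-FKG surplus is nonnegative, given the SET TWO-OBSERVER MARGIN** (hypothesis `h2obs`: for every relay set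
`X' ∋ c` with `c` of least mean and least rank, every vertex `k ∉ X'`,
`μ({O~k}∩{O≁X'}) · Δ_k(X') ≤ μ(k ↮ X') · Δ^r_O(X')` — the set-observer analogue of `PreFKGSurplus.preMargin_nonneg_of_csh` at `D = []`).
Conclusion: `Δ^r_O(X) = Σ_{a∈X} ∫_{P^O_a} (F(C_a) − F(C_c)) ≥ 0` for every relay set `X ∋ c` (`c` of least mean and least
rank, `r` injective on `X`).  Proof = the assembly step of `PreFKGSurplus.kn_conj4_of_csh` with `setObserver_peel_bound` in place of
vdBHK Thm 1.3 (induction on `|X|` only for the degenerate case `μ(k ↮ X') = 0`). [cite: KozmaNitzan2024, Conj. 4 (p. 32), Thm 4 (pp. 12–14)] -/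
theorem setPreSurplus_nonneg_of_twoObs (w : Sym2 (Fin n) → unitInterval) (O : Finset (Fin n)) (F : Set (Fin n) → ℝ)
    (hF : ∀ S T : Set (Fin n), S ⊆ T → F S ≤ F T) (c : Fin n) (r : Fin n → ℕ)
    (h2obs : ∀ (X' : Finset (Fin n)) (k : Fin n), c ∈ X' → k ∉ X' →
      (∀ a ∈ X', ∫ ω, F (openCluster ω c) ∂(prodBernoulli w) ≤ ∫ ω, F (openCluster ω a) ∂(prodBernoulli w)) →
      (∀ a ∈ X', a ≠ c → r c < r a) → Set.InjOn r ↑X' →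
      (prodBernoulli w).real ({ω : BondConfig (Fin n) | ∃ o ∈ O, (openGraph ω).Reachable o k} ∩
          {ω | ∀ o ∈ O, ∀ a ∈ X', ¬ (openGraph ω).Reachable o a}) *
        (∫ ω in ⋃ a ∈ X', openConn k a, (F (openCluster ω k) - F (openCluster ω c)) ∂(prodBernoulli w)) ≤
      (prodBernoulli w).real {ω : BondConfig (Fin n) | ∀ a ∈ (↑X' : Set (Fin n)), ¬ (openGraph ω).Reachable k a} *
        ∑ a ∈ X', ∫ ω in {ω : BondConfig (Fin n) | ∃ o ∈ O, (openGraph ω).Reachable o a} ∩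
          {ω | ∀ a' ∈ X', r a' < r a → ∀ o ∈ O, ¬ (openGraph ω).Reachable o a'},
          (F (openCluster ω a) - F (openCluster ω c)) ∂(prodBernoulli w))
    (X : Finset (Fin n)) (hcX : c ∈ X)
    (hcmin : ∀ a ∈ X, ∫ ω, F (openCluster ω c) ∂(prodBernoulli w) ≤ ∫ ω, F (openCluster ω a) ∂(prodBernoulli w))
    (hrc : ∀ a ∈ X, a ≠ c → r c < r a) (hr : Set.InjOn r ↑X) :
    0 ≤ ∑ a ∈ X, ∫ ω in {ω : BondConfig (Fin n) | ∃ o ∈ O, (openGraph ω).Reachable o a} ∩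
          {ω | ∀ a' ∈ X, r a' < r a → ∀ o ∈ O, ¬ (openGraph ω).Reachable o a'},
          (F (openCluster ω a) - F (openCluster ω c)) ∂(prodBernoulli w) := by
  set μ := prodBernoulli w with hμ
  have hmeas : ∀ S : Set (BondConfig (Fin n)), MeasurableSet S := fun _ => MeasurableSet.of_discrete
  have hint : ∀ (g : BondConfig (Fin n) → ℝ), Integrable g μ := fun g => Integrable.of_finite
  -- strong induction on `|X|`
  suffices main : ∀ (N : ℕ) (X : Finset (Fin n)), X.card = N → c ∈ X →
      (∀ a ∈ X, ∫ ω, F (openCluster ω c) ∂μ ≤ ∫ ω, F (openCluster ω a) ∂μ) →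
      (∀ a ∈ X, a ≠ c → r c < r a) → Set.InjOn r ↑X →
      0 ≤ ∑ a ∈ X, ∫ ω in {ω : BondConfig (Fin n) | ∃ o ∈ O, (openGraph ω).Reachable o a} ∩
          {ω | ∀ a' ∈ X, r a' < r a → ∀ o ∈ O, ¬ (openGraph ω).Reachable o a'},
          (F (openCluster ω a) - F (openCluster ω c)) ∂μ from main X.card X rfl hcX hcmin hrc hr
  intro N
  induction N using Nat.strong_induction_on with
  | _ N ih =>
  intro X hN hcX hcmin hrc hr
  rcases (X.erase c).eq_empty_or_nonempty with h0 | hne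
  · -- `X = {c}`: the only term vanishes
    have hXc : X = {c} := by rw [← Finset.insert_erase hcX, h0]; rfl
    rw [hXc, Finset.sum_singleton]
    rw [setIntegral_congr_fun (hmeas _) (g := fun _ => (0 : ℝ)) (fun ω _ => by simp)]
    simp
  -- peel the rank-maximal relay `k ≠ c`
  obtain ⟨k, hk, hkmax⟩ := Finset.exists_max_image (X.erase c) r hne
  have hkc : k ≠ c := (Finset.mem_erase.1 hk).1
  have hkX : k ∈ X := (Finset.mem_erase.1 hk).2
  have hmax : ∀ a ∈ X, a ≠ k → r a < r k := by
    intro a ha hak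
    by_cases hac : a = c
    · rw [hac]; exact hrc k hkX hkc
    · have hle : r a ≤ r k := hkmax a (Finset.mem_erase.2 ⟨hac, ha⟩)
      exact lt_of_le_of_ne hle fun h => hak (hr (Finset.mem_coe.2 ha) (Finset.mem_coe.2 hkX) h)
  set X' : Finset (Fin n) := X.erase k with hX'
  have hX'X : ∀ a ∈ X', a ∈ X := fun a ha => Finset.mem_of_mem_erase ha
  have hkX' : k ∉ X' := Finset.notMem_erase k X
  have hcX' : c ∈ X' := Finset.mem_erase.2 ⟨hkc.symm, hcX⟩
  have hcard : X'.card < N := by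
    have hpos := Finset.card_pos.2 ⟨k, hkX⟩
    rw [hX', Finset.card_erase_of_mem hkX]; omega
  have hcmin' : ∀ a ∈ X', ∫ ω, F (openCluster ω c) ∂μ ≤ ∫ ω, F (openCluster ω a) ∂μ := fun a ha => hcmin a (hX'X a ha)
  have hrc' : ∀ a ∈ X', a ≠ c → r c < r a := fun a ha hac => hrc a (hX'X a ha) hac
  have hr' : Set.InjOn r ↑X' := hr.mono (by intro a ha; exact Finset.mem_coe.2 (hX'X a (Finset.mem_coe.1 ha)))
  have hIH := ih X'.card hcard X' rfl hcX' hcmin' hrc' hr'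
  rw [setPreSurplus_erase_add w O X r F c k hkX hmax]
  set Dk : Set (BondConfig (Fin n)) := {ω : BondConfig (Fin n) | ∀ a ∈ (↑X' : Set (Fin n)), ¬ (openGraph ω).Reachable k a}
    with hDk
  set Ev : Set (BondConfig (Fin n)) := {ω : BondConfig (Fin n) | ∃ o ∈ O, (openGraph ω).Reachable o k} ∩
    {ω | ∀ o ∈ O, ∀ a ∈ X', ¬ (openGraph ω).Reachable o a} with hEv
  set gk : BondConfig (Fin n) → ℝ := fun ω => F (openCluster ω k) - F (openCluster ω c) with hgk
  set ΔO : ℝ := ∑ a ∈ X', ∫ ω in {ω : BondConfig (Fin n) | ∃ o ∈ O, (openGraph ω).Reachable o a} ∩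
      {ω | ∀ a' ∈ X', r a' < r a → ∀ o ∈ O, ¬ (openGraph ω).Reachable o a'}, (F (openCluster ω a) - F (openCluster ω c)) ∂μ
    with hΔO
  set Δk : ℝ := ∫ ω in ⋃ a' ∈ X', openConn k a', gk ω ∂μ with hΔk
  set T : ℝ := ∫ ω in Ev, gk ω ∂μ with hT
  set J : ℝ := ∫ ω in Dk, gk ω ∂μ with hJ
  set M : ℝ := μ.real Dk with hM
  set E : ℝ := μ.real Ev with hE
  have hEvD : Ev ⊆ Dk := by
    rintro ω ⟨⟨o, ho, hok⟩, h2⟩ a ha hka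
    exact h2 o ho a (Finset.mem_coe.1 ha) (hok.trans hka)
  have hE0 : 0 ≤ E := measureReal_nonneg
  have hM0 : 0 ≤ M := measureReal_nonneg
  -- `J = (m_k − m_c) − Δ_k(X')`
  have hJtot : J = ((∫ ω, F (openCluster ω k) ∂μ) - ∫ ω, F (openCluster ω c) ∂μ) - Δk := by
    have h1 := integral_add_compl (hmeas Dk) (hint gk)
    have hDkc : Dkᶜ = ⋃ a' ∈ X', (openConn k a' : Set (BondConfig (Fin n))) := by
      ext ω
      rw [PreFKGSurplus.mem_iUnion_openConn, mem_compl_iff, hDk]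
      simp only [mem_setOf_eq, Finset.mem_coe, not_forall, not_not, exists_prop]
    have h2 : ∫ ω in Dkᶜ, gk ω ∂μ = Δk := by rw [hDkc]
    have h3 : ∫ ω, gk ω ∂μ = (∫ ω, F (openCluster ω k) ∂μ) - ∫ ω, F (openCluster ω c) ∂μ := by
      rw [hgk, integral_sub (hint _) (hint _)]
    rw [hJ]; linarith
  have hmk : 0 ≤ (∫ ω, F (openCluster ω k) ∂μ) - ∫ ω, F (openCluster ω c) ∂μ := by linarith [hcmin k hkX]
  -- the two-set bound `E·J ≤ M·T` and the set two-observer margin `E·Δk ≤ M·ΔO`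
  have hpeel : E * J ≤ M * T := setObserver_peel_bound w X' O F hF c k hcX'
  have h2 : E * Δk ≤ M * ΔO := h2obs X' k hcX' hkX' hcmin' hrc' hr'
  rcases hM0.eq_or_lt with hM00 | hMpos
  · -- degenerate case `μ(k ↮ X') = 0`: the peeled term vanishes, use the induction hypothesis
    have hD0 : μ Dk = 0 := (measureReal_eq_zero_iff (measure_ne_top μ Dk)).1 hM00.symm
    have hEv0 : μ Ev = 0 := measure_mono_null hEvD hD0
    have hT0 : T = 0 := setIntegral_measure_zero _ hEv0
    rw [hT0, add_zero]
    exact hIH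
  · have hfin : 0 ≤ M * (ΔO + T) := by
      have : E * ((∫ ω, F (openCluster ω k) ∂μ) - ∫ ω, F (openCluster ω c) ∂μ) ≤ M * (ΔO + T) := by
        nlinarith [hpeel, h2, hJtot]
      nlinarith [mul_nonneg hE0 hmk, this]
    exact le_of_mul_le_mul_left (by rw [mul_zero]; exact hfin) hMpos

end SetSurplus

end Summit.CriticalPhenomena.PercolationContinuityZ3.Theorems

end
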